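import Summits.AnomalousDissipation.AnomalousDissipation.Theorems.ScalarZerothLawKinematicPeriod
import HarnessLib

/-!
# Scalar zeroth law over a prescribed carrier — the injection on the quiet and active phases

Cell `ad-ideate`, planner ad-ideate-p1 ROUND-10 §B3, Steps 3–4, for an `L²`-continuous global weak
solution `w` of `∂ₜθ + b·∇θ = κ ∑ᵢ aᵢ ∂ᵢ∂ᵢθ + S` with bounded drift, steady smooth source `S`,
`κ > 0`, `aᵢ > 0` (setting of `ScalarZerothLawKinematicPeriod.lean`; `N(t) = ‖w(t)‖_{L²}`,
`σ_S = ‖S‖_{L²}`, injection `s(t) = ∫ S w(t)`):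

* `le_integral_quiet_injection` — if `b = 0` on the quiet part `(nL + 1, (n+1)L)` then
  `∫₀^{L-1} s(nL+1+τ) dτ ≥ -(L-1) N σ_S + ½(L-1)² (σ_S² - κ K (N + (L-1)σ_S))`, `N = N(nL+1)`,
  `K ≥ ‖∑ᵢ aᵢ∂ᵢ∂ᵢS‖_{L²}` — the trace identity with `g = S` (no drift term), Cauchy–Schwarz and the
  growth bound: a steady source injects `‖S‖²` per unit time into a field it is not stirred away
  from, up to the diffusive correction `κ K N`;
* `le_integral_active_injection` — on any unit interval `∫₀¹ s(σ+τ) dτ ≥ -σ_S (N(σ) + σ_S)`.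

Supports stmt-AnomalousDissipation-0448 (prescribed-carrier rung; no statement about Navier–Stokes).
-/

noncomputable section

-- `Summit.<Summit>.<Problem>` is the tree's mandated summit-side namespace (CONVENTIONS §2); for this
-- single-conjunct summit the two coincide, so the duplicate is deliberate.
set_option linter.dupNamespace false

namespace Summit.AnomalousDissipation.AnomalousDissipation.Theorems.ScalarZerothLawKinematic

open MeasureTheory Set Filter Topology
open scoped NNReal ENNReal InnerProductSpace
open Literature.Analysis Literature.Analysis.FluidPDE Literature.Analysis.FunctionSpaces
open Literature.Analysis.FluidPDE.Torus Literature.Analysis.FunctionSpaces.Torus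

section Injection

variable {d : Type*} [Fintype d] [DecidableEq d]
  {a : d → ℝ} {κ L A : ℝ} {b : ℝ → UnitAddTorus d → EuclideanSpace ℝ d}
  {S θ₀ : UnitAddTorus d → ℝ} {w : ℝ → UnitAddTorus d → ℝ}

omit [DecidableEq d] in
/-- Cauchy–Schwarz in `L²(T^d)`: `|∫ f g| ≤ √(∫ f²) √(∫ g²)` (a private copy of
`Torus.DEIJ.abs_integral_mul_le_sqrt`, to keep the import cone small). -/
private theorem abs_integral_mul_le_sqrt_integral_sq {f g : UnitAddTorus d → ℝ} (hf : MemLp f 2 volume)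
    (hg : MemLp g 2 volume) :
    |∫ x, f x * g x| ≤ Real.sqrt (∫ x, f x ^ 2) * Real.sqrt (∫ x, g x ^ 2) := by
  have hf' : MemLp f (ENNReal.ofReal 2) volume := by rwa [ENNReal.ofReal_ofNat]
  have hg' : MemLp g (ENNReal.ofReal 2) volume := by rwa [ENNReal.ofReal_ofNat]
  have h := integral_mul_norm_le_Lp_mul_Lq (μ := volume) Real.HolderConjugate.two_two hf' hg'
  have e2 : ∀ (w : UnitAddTorus d → ℝ), (∫ a, ‖w a‖ ^ (2 : ℝ)) ^ (1 / (2 : ℝ)) = Real.sqrt (∫ a, w a ^ 2) := by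
    intro w
    rw [Real.sqrt_eq_rpow]
    congr 1
    refine integral_congr_ae (Eventually.of_forall fun a => ?_)
    dsimp only
    rw [Real.rpow_two, Real.norm_eq_abs, sq_abs]
  rw [e2, e2] at h
  refine le_trans ?_ h
  calc |∫ x, f x * g x| ≤ ∫ x, |f x * g x| := abs_integral_le_integral_abs
    _ = ∫ x, ‖f x‖ * ‖g x‖ := integral_congr_ae (Eventually.of_forall fun x => by
        simp [abs_mul, Real.norm_eq_abs])

/-- **Step 3, the quiet-phase injection.** Let `w` be as above and suppose the drift vanishes on the
quiet part of period `n`: `b(t) = 0` for `nL + 1 < t < (n+1)L` (`L > 1`). Then the injection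
`s(t) = ∫ S w(t)` over the quiet part is bounded below:
`∫₀^{L-1} s(nL + 1 + τ) dτ ≥ -(L-1) N σ_S + ½ (L-1)² (σ_S² - κ K (N + (L-1) σ_S))`, where
`N = ‖w(nL + 1)‖_{L²}`, `σ_S = ‖S‖_{L²}` and `K ≥ ‖∑ᵢ aᵢ ∂ᵢ∂ᵢ S‖_{L²}`: by the trace identity with
`g = S` (the drift term is absent), `s(nL+1+τ) = s(nL+1) + ∫₀^τ (κ ∫ w · ∑ᵢaᵢ∂ᵢ∂ᵢS + ‖S‖²)`, and
`|∫ w(t) · ∑ᵢaᵢ∂ᵢ∂ᵢS| ≤ N(t) K ≤ (N + (L-1)σ_S) K` on the quiet part (growth). -/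
theorem le_integral_quiet_injection (hw : IsWeakScalarTransportDiagForced a κ b (fun _ => S) θ₀ w)
    (hwc : IsL2ContinuousOn (Ici 0) w) (hκ : 0 < κ) (ha : ∀ i, 0 < a i) (hθ₀ : MemLp θ₀ 2 volume)
    (hS : IsSmooth S) (hbA : ∀ (t : ℝ) (x : UnitAddTorus d), ‖b t x‖ ≤ A) (hL : 1 < L) {K : ℝ}
    (hKm : MemLp (fun x => ∑ i, a i * FunctionSpaces.Torus.partialDeriv i (FunctionSpaces.Torus.partialDeriv i S) x)
      2 volume)
    (hK : Real.sqrt (∫ x, (∑ i, a i * FunctionSpaces.Torus.partialDeriv i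
      (FunctionSpaces.Torus.partialDeriv i S) x) ^ 2) ≤ K)
    {n : ℕ} (hb0 : ∀ t : ℝ, (n : ℝ) * L + 1 < t → t < ((n : ℝ) + 1) * L → b t = 0) :
    -(L - 1) * Real.sqrt (∫ x, w ((n : ℝ) * L + 1) x ^ 2) * Real.sqrt (∫ x, S x ^ 2) +
      (L - 1) ^ 2 / 2 * ((∫ x, S x ^ 2) - κ * K *
        (Real.sqrt (∫ x, w ((n : ℝ) * L + 1) x ^ 2) + (L - 1) * Real.sqrt (∫ x, S x ^ 2))) ≤
      ∫ τ in (0 : ℝ)..(L - 1), ∫ x, S x * w ((n : ℝ) * L + 1 + τ) x := by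
  set t₁ : ℝ := (n : ℝ) * L + 1 with ht₁def
  set ℓ : ℝ := L - 1 with hℓdef
  have ht₁ : 0 ≤ t₁ := by positivity
  have hℓ : 0 < ℓ := by rw [hℓdef]; linarith
  have hL0 : 0 < L := by linarith
  have hS2 : MemLp S 2 volume := hS.memLp 2
  set σS : ℝ := Real.sqrt (∫ x, S x ^ 2) with hσS
  set N : ℝ := Real.sqrt (∫ x, w t₁ x ^ 2) with hN
  have hσS0 : 0 ≤ σS := Real.sqrt_nonneg _
  have hN0 : 0 ≤ N := Real.sqrt_nonneg _
  have hK0 : 0 ≤ K := (Real.sqrt_nonneg _).trans hK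
  -- restart at `t₁`, horizon `L`
  have hrest := hw.translate_of_isL2ContinuousOn hwc ht₁
  have hL1 : IsWeakScalarTransportDiagForcedOn L a κ (fun t => b (t₁ + t)) (fun _ => S) (w t₁)
      (fun t => w (t₁ + t)) := hrest L hL0
  have hc1 : IsL2ContinuousOn (Icc 0 L) (fun t => w (t₁ + t)) := isL2ContinuousOn_shift hwc ht₁ L
  -- growth on the quiet part: `N(t₁ + τ) ≤ N + ℓ σS` for `τ ∈ [0, ℓ]`
  have hgrow : ∀ τ ∈ Icc 0 ℓ, Real.sqrt (∫ x, w (t₁ + τ) x ^ 2) ≤ N + ℓ * σS := by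
    intro τ hτ
    have h := sqrt_integral_sq_le_add_mul hw hwc hκ ha hθ₀ hbA hS2 ht₁ (show t₁ ≤ t₁ + τ by linarith [hτ.1])
    have e : t₁ + τ - t₁ = τ := by ring
    rw [e] at h
    have : τ * σS ≤ ℓ * σS := mul_le_mul_of_nonneg_right hτ.2 hσS0
    linarith
  -- the integrand of the trace identity and its lower bound on `(0, ℓ)`
  set Φ : ℝ → ℝ := fun τ => (∫ x, w (t₁ + τ) x * (⟪b (t₁ + τ) x, gradient S x⟫_ℝ +
      κ * ∑ i, a i * FunctionSpaces.Torus.partialDeriv i (FunctionSpaces.Torus.partialDeriv i S) x)) +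
      ∫ x, S x * S x with hΦ
  set c₀ : ℝ := (∫ x, S x ^ 2) - κ * K * (N + ℓ * σS) with hc₀
  have hΦge : ∀ τ ∈ Ioo 0 ℓ, c₀ ≤ Φ τ := by
    intro τ hτ
    have hbz : b (t₁ + τ) = 0 := hb0 (t₁ + τ) (by rw [ht₁def]; linarith [hτ.1])
      (by rw [ht₁def]; rw [hℓdef] at hτ; linarith [hτ.2])
    have hwm : MemLp (w (t₁ + τ)) 2 volume := hwc.memLp (show t₁ + τ ∈ Ici 0 by
      simp only [mem_Ici]; linarith [hτ.1])
    have e1 : Φ τ = κ * (∫ x, w (t₁ + τ) x * (∑ i, a i * FunctionSpaces.Torus.partialDeriv i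
        (FunctionSpaces.Torus.partialDeriv i S) x)) + ∫ x, S x ^ 2 := by
      simp only [hΦ, hbz, Pi.zero_apply, inner_zero_left, zero_add]
      rw [← integral_const_mul]
      congr 1
      · exact integral_congr_ae (Eventually.of_forall fun x => by ring)
      · exact integral_congr_ae (Eventually.of_forall fun x => by ring)
    have hcs := abs_integral_mul_le_sqrt_integral_sq hwm hKm
    have h1 : -(Real.sqrt (∫ x, w (t₁ + τ) x ^ 2) * K) ≤ ∫ x, w (t₁ + τ) x *
        (∑ i, a i * FunctionSpaces.Torus.partialDeriv i (FunctionSpaces.Torus.partialDeriv i S) x) := by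
      have h2 := neg_abs_le (∫ x, w (t₁ + τ) x *
        (∑ i, a i * FunctionSpaces.Torus.partialDeriv i (FunctionSpaces.Torus.partialDeriv i S) x))
      have h3 : Real.sqrt (∫ x, w (t₁ + τ) x ^ 2) * Real.sqrt (∫ x, (∑ i, a i *
          FunctionSpaces.Torus.partialDeriv i (FunctionSpaces.Torus.partialDeriv i S) x) ^ 2) ≤
          Real.sqrt (∫ x, w (t₁ + τ) x ^ 2) * K := mul_le_mul_of_nonneg_left hK (Real.sqrt_nonneg _)
      linarith
    have h4 : Real.sqrt (∫ x, w (t₁ + τ) x ^ 2) * K ≤ (N + ℓ * σS) * K :=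
      mul_le_mul_of_nonneg_right (hgrow τ ⟨hτ.1.le, hτ.2.le⟩) hK0
    rw [e1, hc₀]
    nlinarith [mul_le_mul_of_nonneg_left (le_trans (neg_le_neg h4) h1) hκ.le]
  -- the trace identity at every `τ ∈ [0, L]`
  have htrace : ∀ τ ∈ Icc 0 L, ∫ x, w (t₁ + τ) x * S x = (∫ x, w t₁ x * S x) + ∫ τ' in Ioc 0 τ, Φ τ' :=
    fun τ hτ => hL1.trace_of_isL2ContinuousOn hL0 hc1 hS hτ
  -- integrability of `Φ` on `[0, L]`
  have hΦI : IntegrableOn Φ (Icc 0 L) volume := by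
    have h0 : IntegrableOn Φ (Ioo 0 L) volume :=
      (hL1.integrable_mul_steadyFlux hS).integral_prod_left.add
        (hL1.integrable_source_mul_continuous hS.continuous).integral_prod_left
    exact h0.congr_set_ae Ioo_ae_eq_Icc.symm
  -- lower bound of `s` on `[0, ℓ]`
  have hsge : ∀ τ ∈ Icc 0 ℓ, -(N * σS) + τ * c₀ ≤ ∫ x, S x * w (t₁ + τ) x := by
    intro τ hτ
    have hτL : τ ∈ Icc 0 L := ⟨hτ.1, hτ.2.trans (by rw [hℓdef]; linarith)⟩
    have e : ∫ x, S x * w (t₁ + τ) x = ∫ x, w (t₁ + τ) x * S x :=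
      integral_congr_ae (Eventually.of_forall fun x => mul_comm _ _)
    rw [e, htrace τ hτL]
    have hs0 : -(N * σS) ≤ ∫ x, w t₁ x * S x := by
      have := neg_abs_le (∫ x, w t₁ x * S x)
      have := abs_integral_mul_le_sqrt_integral_sq (hwc.memLp (mem_Ici.2 ht₁)) hS2
      linarith
    have hint : τ * c₀ ≤ ∫ τ' in Ioc 0 τ, Φ τ' := by
      have hsub : Ioc 0 τ ⊆ Icc 0 L := fun x hx => ⟨hx.1.le, hx.2.trans hτL.2⟩
      have hc : ∫ _ in Ioc 0 τ, c₀ = τ * c₀ := by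
        rw [setIntegral_const, Real.volume_real_Ioc_of_le hτ.1, sub_zero, smul_eq_mul]
      rw [← hc]
      have hne : ∀ᵐ τ' ∂(volume : Measure ℝ), τ' ∉ ({τ} : Set ℝ) :=
        measure_eq_zero_iff_ae_notMem.1 (measure_singleton τ)
      refine setIntegral_mono_on_ae (integrableOn_const (hs := measure_Ioc_lt_top.ne)) (hΦI.mono_set hsub)
        measurableSet_Ioc ?_
      filter_upwards [hne] with τ' hne' hτ'
      have hlt : τ' < τ := lt_of_le_of_ne hτ'.2 fun h => hne' (by simp [h])
      exact hΦge τ' ⟨hτ'.1, hlt.trans_le hτ.2⟩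
    linarith
  -- integrate over the quiet part
  have hcont : ContinuousOn (fun τ => ∫ x, S x * w (t₁ + τ) x) (Icc 0 ℓ) := by
    have h := (hc1.continuousOn_integral_mul hS2).mono (Icc_subset_Icc le_rfl (by rw [hℓdef]; linarith : ℓ ≤ L))
    refine h.congr fun τ _ => ?_
    exact integral_congr_ae (Eventually.of_forall fun x => mul_comm _ _)
  have hi_lin : IntervalIntegrable (fun τ : ℝ => -(N * σS) + τ * c₀) volume 0 ℓ :=
    (by fun_prop : Continuous fun τ : ℝ => -(N * σS) + τ * c₀).intervalIntegrable 0 ℓ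
  have hi_s : IntervalIntegrable (fun τ => ∫ x, S x * w (t₁ + τ) x) volume 0 ℓ :=
    hcont.intervalIntegrable_of_Icc hℓ.le
  have hmono := intervalIntegral.integral_mono_on hℓ.le hi_lin hi_s hsge
  have hi_c : IntervalIntegrable (fun _ : ℝ => -(N * σS)) volume 0 ℓ :=
    (continuous_const (y := -(N * σS))).intervalIntegrable 0 ℓ
  have hi_id : IntervalIntegrable (fun τ : ℝ => τ * c₀) volume 0 ℓ :=
    (by fun_prop : Continuous fun τ : ℝ => τ * c₀).intervalIntegrable 0 ℓ
  have hlin : ∫ τ in (0 : ℝ)..ℓ, (-(N * σS) + τ * c₀) = -(N * σS) * ℓ + ℓ ^ 2 / 2 * c₀ := by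
    rw [intervalIntegral.integral_add hi_c hi_id, intervalIntegral.integral_const,
      intervalIntegral.integral_mul_const, integral_id]
    simp only [sub_zero, smul_eq_mul]
    ring
  rw [hlin] at hmono
  convert hmono using 1
  rw [hc₀]
  ring

/-- **Step 4, the injection on an active unit**: for `σ ≥ 0`,
`∫₀¹ s(σ + τ) dτ ≥ -σ_S (‖w(σ)‖_{L²} + σ_S)` with `s(t) = ∫ S w(t)`, `σ_S = ‖S‖_{L²}`
(Cauchy–Schwarz and the growth bound on `[σ, σ + 1]`). -/
theorem le_integral_active_injection (hw : IsWeakScalarTransportDiagForced a κ b (fun _ => S) θ₀ w)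
    (hwc : IsL2ContinuousOn (Ici 0) w) (hκ : 0 < κ) (ha : ∀ i, 0 < a i) (hθ₀ : MemLp θ₀ 2 volume)
    (hS2 : MemLp S 2 volume) (hbA : ∀ (t : ℝ) (x : UnitAddTorus d), ‖b t x‖ ≤ A) {σ : ℝ} (hσ : 0 ≤ σ) :
    -(Real.sqrt (∫ x, S x ^ 2) * (Real.sqrt (∫ x, w σ x ^ 2) + Real.sqrt (∫ x, S x ^ 2))) ≤
      ∫ τ in (0 : ℝ)..1, ∫ x, S x * w (σ + τ) x := by
  set σS : ℝ := Real.sqrt (∫ x, S x ^ 2) with hσS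
  set N : ℝ := Real.sqrt (∫ x, w σ x ^ 2) with hN
  have hσS0 : 0 ≤ σS := Real.sqrt_nonneg _
  have hc1 : IsL2ContinuousOn (Icc 0 1) (fun t => w (σ + t)) := isL2ContinuousOn_shift hwc hσ 1
  have hcont : ContinuousOn (fun τ => ∫ x, S x * w (σ + τ) x) (Icc 0 1) := by
    refine (hc1.continuousOn_integral_mul hS2).congr fun τ _ => ?_
    exact integral_congr_ae (Eventually.of_forall fun x => mul_comm _ _)
  have hge : ∀ τ ∈ Icc (0 : ℝ) 1, -(σS * (N + σS)) ≤ ∫ x, S x * w (σ + τ) x := by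
    intro τ hτ
    have hwm : MemLp (w (σ + τ)) 2 volume := hwc.memLp (show σ + τ ∈ Ici 0 by
      simp only [mem_Ici]; linarith [hτ.1])
    have hcs := abs_integral_mul_le_sqrt_integral_sq hS2 hwm
    have hg := sqrt_integral_sq_le_add_mul hw hwc hκ ha hθ₀ hbA hS2 hσ (show σ ≤ σ + τ by linarith [hτ.1])
    have e : σ + τ - σ = τ := by ring
    rw [e] at hg
    have h1 : Real.sqrt (∫ x, w (σ + τ) x ^ 2) ≤ N + σS := by
      have : τ * σS ≤ 1 * σS := mul_le_mul_of_nonneg_right hτ.2 hσS0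
      linarith
    have h2 := neg_abs_le (∫ x, S x * w (σ + τ) x)
    have h3 : σS * Real.sqrt (∫ x, w (σ + τ) x ^ 2) ≤ σS * (N + σS) := mul_le_mul_of_nonneg_left h1 hσS0
    linarith
  have hi_c : IntervalIntegrable (fun _ : ℝ => -(σS * (N + σS))) volume 0 1 :=
    (continuous_const (y := -(σS * (N + σS)))).intervalIntegrable 0 1
  have hi_s : IntervalIntegrable (fun τ => ∫ x, S x * w (σ + τ) x) volume 0 1 :=
    hcont.intervalIntegrable_of_Icc zero_le_one
  have hmono := intervalIntegral.integral_mono_on zero_le_one hi_c hi_s hge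
  rw [intervalIntegral.integral_const, sub_zero, one_smul] at hmono
  exact hmono

end Injection

end Summit.AnomalousDissipation.AnomalousDissipation.Theorems.ScalarZerothLawKinematic

end
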